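import Summits.BirchSwinnertonDyer.BirchSwinnertonDyer.Theorems.CyclotomicUntwistGNineKernelGeneric
import HarnessLib

/-!
# The wild analogue `(G₉)` at `3`: geometric kernel II — the explicit witnesses over `ℚ(ζ₉)`

Route `CyclotomicUntwist`, crux `PSRankOneLowerHalfAtThree` (item stmt-BirchSwinnertonDyer-21580),
line `birth`, stub `stub_gNineCriterion` (FIRST LEMMA `GNineCriterion`). Sequel of
`CyclotomicUntwistGNineKernelGeneric.lean`: over a number field `F` with a primitive `9`-th root of
unity `ζ` and a place `w` with `w(ζ − 1) = exp(−1)`, `w(3) = exp(−6)`, the curve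
`y² = x³ + A x² + B x + C` (`A, B, C ∈ ℤ`) has good reduction at `w` in each of the three residue
patterns that a `3`-adic-square discriminant produces on the wild cell at `3` (Kraus 1990, types at
`p = 3`; the patterns are derived from the discriminant in `CyclotomicUntwistGNineArithmetic.lean`):
* `hasGoodReductionAt_of_pattern_four` — `v₃(disc) = 4` (Kodaira II rows): `A ≡ 3ε, B ≡ 0,
  C ≡ −3ε (mod 9)`; witness `r = ε·ϖ`, `u = (ζ−1)²`, where `ϖ = 2 − ζ − ζ⁻¹` is a uniformizer of
  `ℚ(ζ₉)⁺` (`ϖ³ = 3 − 9ϖ + 6ϖ²`, `w(ϖ) = exp(−2)`);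
* `hasGoodReductionAt_of_pattern_six_zero` — `v₃(disc) = 6`, `3 ∣ A, 9 ∣ B, 27 ∣ C` (Kodaira I₀*
  shape): `r = 0`, `u = (ζ−1)³`;
* `hasGoodReductionAt_of_pattern_six` — `v₃(disc) = 6`, `9 ∣ A, B ≡ −9, C ≡ −9ε (mod 27)`
  (Kodaira IV rows): `r = ε·ϖ²`, `u = (ζ−1)³`;
* `hasGoodReductionAt_iff_twistScale` — the `ℚ(√−3)`-twist-and-rescale
  `(3a, 9b, 27c) ↦ (−a, b, −c)` (`u = √−3 = 2ζ³ + 1`), lowering `v₃(disc)` by `6`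
  (Kodaira IV* ↦ II, II* ↦ IV).
The arithmetic behind the witnesses: the three roots `θᵢ` of the cubic are pairwise at distance
`3^{−v/6}` (`ord₃ j ≥ 0`), and `r` must lie within that distance of all of them; on the square rows
the `ℚ₃(ζ₉)`-rational truncation of `θ₁` to that precision is `ε ϖ^{v/2 − 1}` after the cusp
translation (Frobenius-stable cubic inertia character; Kraus's `C₃/C₆` with square discriminant).

Theorems only; no definition, no named fact; nothing about BSD is asserted.
References: A. Kraus, Manuscripta Math. 69 (1990) 353–385; J. H. Silverman, *AEC* VII.1, VII.5.1,
X.5.4 (twists).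
-/

noncomputable section

open scoped Classical NumberField

open WeierstrassCurve IsDedekindDomain IsDedekindDomain.HeightOneSpectrum NumberField
  WithZero

set_option linter.dupNamespace false

namespace Summit.BirchSwinnertonDyer.BirchSwinnertonDyer.Theorems.GNineCriterion

section Nine

variable {F : Type*} [Field F] [NumberField F] {ζ : F} (hζ : IsPrimitiveRoot ζ 9)
  (w : HeightOneSpectrum (𝓞 F))

include hζ in
omit [NumberField F] in
/-- `Φ₉(ζ) = ζ⁶ + ζ³ + 1 = 0` for a primitive `9`-th root of unity `ζ`. [folklore] -/
theorem cyclotomic_nine_eval : ζ ^ 6 + ζ ^ 3 + 1 = 0 := by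
  have h9 : ζ ^ 9 = 1 := hζ.pow_eq_one
  have h3 : ζ ^ 3 ≠ 1 := hζ.pow_ne_one_of_pos_of_lt (by norm_num) (by norm_num)
  have hfac : (ζ ^ 3 - 1) * (ζ ^ 6 + ζ ^ 3 + 1) = 0 := by linear_combination h9
  rcases mul_eq_zero.mp hfac with h | h
  · exact absurd (sub_eq_zero.mp h) h3
  · exact h

include hζ in
omit [NumberField F] in
/-- `ϖ³ = 3 − 9ϖ + 6ϖ²` for `ϖ = 2 − ζ − ζ⁻¹` (its minimal polynomial is `x³ − 6x² + 9x − 3`,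
that of `ζ + ζ⁻¹` being `x³ − 3x + 1`). [folklore] -/
theorem varpi_cube :
    (2 - ζ - ζ ^ 8 : F) ^ 3 = 3 - 9 * (2 - ζ - ζ ^ 8) + 6 * (2 - ζ - ζ ^ 8) ^ 2 := by
  have h9 : ζ ^ 9 = 1 := hζ.pow_eq_one
  have hΦ := cyclotomic_nine_eval hζ
  linear_combination (-3 * ζ - ζ ^ 6 - 3 * ζ ^ 8 - ζ ^ 15) * h9 + (-1 : F) * hΦ

include hζ in
omit [NumberField F] in
/-- `√−3 = 2ζ³ + 1`: `(2ζ³ + 1)² = −3`. [folklore] -/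
theorem sq_two_zeta_cube_add_one : (2 * ζ ^ 3 + 1 : F) ^ 2 = -3 := by
  linear_combination (4 : F) * cyclotomic_nine_eval hζ

include hζ in
/-- The valuation of `ζ` is `1` (a unit of `𝓞 F`). [folklore] -/
theorem val_zeta : w.valuation F ζ = 1 := by
  have hle : ∀ k : ℕ, w.valuation F (ζ ^ k) ≤ 1 := fun k ↦ by
    have : (ζ ^ k : F) = algebraMap (𝓞 F) F (hζ.toInteger ^ k) := by simp
    rw [this]; exact valuation_le_one w _
  have h1 : w.valuation F ζ * w.valuation F (ζ ^ 8) = 1 := by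
    rw [← map_mul, ← pow_succ', hζ.pow_eq_one, map_one]
  have hζ1 : w.valuation F ζ ≤ 1 := by simpa using hle 1
  by_contra hne
  have hlt : w.valuation F ζ < 1 := lt_of_le_of_ne hζ1 hne
  exact absurd h1 (mul_lt_one_of_lt_of_le hlt (hle 8)).ne

variable (hπ : w.valuation F (ζ - 1) = exp (-1 : ℤ)) (h3 : w.valuation F (3 : F) = exp (-6 : ℤ))
  (hcop : ∀ n : ℤ, ¬ (3 : ℤ) ∣ n → w.valuation F (n : F) = 1)

include hζ hπ in
/-- `w(ϖ) = exp(−2)` for `ϖ = 2 − ζ − ζ⁻¹ = −(ζ − 1)² ζ⁻¹`. [folklore] -/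
theorem val_varpi : w.valuation F (2 - ζ - ζ ^ 8) = exp (-2 : ℤ) := by
  have h9 : ζ ^ 9 = 1 := hζ.pow_eq_one
  have hϖ : (2 - ζ - ζ ^ 8 : F) = -((ζ - 1) ^ 2 * ζ ^ 8) := by linear_combination (ζ - 2) * h9
  rw [hϖ, Valuation.map_neg, map_mul, map_pow, map_pow, hπ, val_zeta hζ w, one_pow, mul_one,
    ← exp_nsmul]
  norm_num

include hπ in
/-- `ζ − 1 ≠ 0`. [folklore] -/
theorem zeta_sub_one_ne_zero' : (ζ - 1 : F) ≠ 0 := by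
  intro h0; rw [h0, map_zero] at hπ; exact WithZero.coe_ne_zero hπ.symm

include h3 in
/-- `w(3k) ≤ exp(−6)`, `w(9k) ≤ exp(−12)`, `w(27k) ≤ exp(−18)` for an integer `k`. [folklore] -/
theorem val_three_pow_mul_le (j : ℕ) (k : ℤ) :
    w.valuation F (((3 ^ j * k : ℤ) : F)) ≤ exp (-(6 * j : ℤ)) := by
  push_cast
  rw [map_mul, map_pow, h3, ← exp_nsmul]
  calc exp (j • (-6 : ℤ)) * w.valuation F (k : F) ≤ exp (j • (-6 : ℤ)) * 1 := by
        gcongr; exact val_intCast_le w k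
    _ = exp (-(6 * j : ℤ)) := by rw [mul_one]; congr 1; simp [mul_comm]

include hζ hπ h3 hcop in
/-- **Kernel, `v₃(disc) = 4` (Kodaira II rows of the principal-series cell).** For integers with
`A = 3ε + 9α'`, `B = 9β'`, `C = −3ε + 9γ'` (`ε = ±1`) and `disc = 81·d`, `3 ∤ d`, the curve
`y² = x³ + A x² + B x + C` has good reduction at `w`: witness `r = ε ϖ`, `u = (ζ − 1)²`.
[cite: Kraus1990, Théorème 1 (p = 3)] -/
theorem hasGoodReductionAt_of_pattern_four (A B C ε α' β' γ' d : ℤ) (hε : ε = 1 ∨ ε = -1)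
    (hA : A = 3 * ε + 9 * α') (hB : B = 9 * β') (hC : C = -3 * ε + 9 * γ')
    (hD : A ^ 2 * B ^ 2 - 4 * B ^ 3 - 4 * A ^ 3 * C - 27 * C ^ 2 + 18 * A * B * C = 81 * d)
    (hd : ¬ (3 : ℤ) ∣ d) :
    (⟨0, (A : F), 0, (B : F), (C : F)⟩ : WeierstrassCurve F).HasGoodReductionAt w := by
  set ϖ : F := 2 - ζ - ζ ^ 8 with hϖdef
  have hvϖ : w.valuation F ϖ = exp (-2 : ℤ) := val_varpi hζ w hπ
  have hϖ3 : ϖ ^ 3 = 3 - 9 * ϖ + 6 * ϖ ^ 2 := varpi_cube hζ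
  have hπ0 : (ζ - 1 : F) ≠ 0 := zeta_sub_one_ne_zero' w hπ
  have hu0 : (ζ - 1) ^ 2 ≠ 0 := pow_ne_zero _ hπ0
  have hvu : w.valuation F ((ζ - 1) ^ 2) = exp (-2 : ℤ) := by
    rw [map_pow, hπ, ← exp_nsmul]; norm_num
  have hvε : w.valuation F (ε : F) = 1 := by rcases hε with rfl | rfl <;> simp
  have hv9 : w.valuation F (9 : F) = exp (-12 : ℤ) := by
    rw [show (9 : F) = 3 ^ 2 by norm_num, map_pow, h3, ← exp_nsmul]; norm_num
  have hvA : w.valuation F (A : F) ≤ exp (-6 : ℤ) := by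
    have : (A : F) = ((3 ^ 1 * (ε + 3 * α') : ℤ) : F) := by rw [hA]; push_cast; ring
    rw [this]; simpa using val_three_pow_mul_le w h3 1 (ε + 3 * α')
  have hvB : w.valuation F (B : F) ≤ exp (-12 : ℤ) := by
    have : (B : F) = ((3 ^ 2 * β' : ℤ) : F) := by rw [hB]; push_cast; ring
    rw [this]; simpa using val_three_pow_mul_le w h3 2 β'
  refine hasGoodReductionAt_of_translate_scale w (A : F) (B : F) (C : F) ((ε : F) * ϖ)
    ((ζ - 1) ^ 2) hu0 ?_ ?_ ?_ ?_
  · -- `w(A + 3r) ≤ exp(-4)`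
    rw [hvu, ← exp_nsmul]
    refine val_add_le w (hvA.trans (exp_le_exp.mpr (by norm_num))) ?_
    rw [map_mul, map_mul, h3, hvε, hvϖ, one_mul, ← exp_add]
    exact exp_le_exp.mpr (by norm_num)
  · -- `w(B + 2rA + 3r²) ≤ exp(-8)`
    rw [hvu, ← exp_nsmul]
    refine val_add_le w (val_add_le w (hvB.trans (exp_le_exp.mpr (by norm_num))) ?_) ?_
    · rw [map_mul, map_mul, map_mul, hvε, hvϖ, one_mul]
      calc w.valuation F 2 * exp (-2 : ℤ) * w.valuation F (A : F)
          ≤ 1 * exp (-2 : ℤ) * exp (-6 : ℤ) := by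
            gcongr
            · simpa using val_intCast_le w 2
        _ = exp (-8 : ℤ) := by rw [one_mul, ← exp_add]; norm_num
    · rw [map_mul, map_pow, map_mul, hvε, hvϖ, h3, one_mul, ← exp_nsmul, ← exp_add]
      exact exp_le_exp.mpr (by norm_num)
  · -- `w(C + rB + r²A + r³) ≤ exp(-12)`: the cancellation `−3ε + ε·3 = 0`
    have key : (C : F) + ((ε : F) * ϖ) * (B : F) + ((ε : F) * ϖ) ^ 2 * (A : F) + ((ε : F) * ϖ) ^ 3
        = 9 * ((γ' : F) + ((β' : F) - 1) * (ε : F) * ϖ + ((α' : F) + (ε : F)) * ϖ ^ 2) := by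
      rw [hA, hB, hC]; push_cast
      rcases hε with rfl | rfl
      · push_cast; linear_combination hϖ3
      · push_cast; linear_combination -hϖ3
    rw [key, hvu, ← exp_nsmul, map_mul, hv9]
    have hX : w.valuation F
        ((γ' : F) + ((β' : F) - 1) * (ε : F) * ϖ + ((α' : F) + (ε : F)) * ϖ ^ 2) ≤ 1 := by
      refine val_add_le w (val_add_le w (val_intCast_le w _) ?_) ?_
      · rw [map_mul, map_mul, hvε, hvϖ, mul_one]
        have : w.valuation F ((β' : F) - 1) ≤ 1 := by simpa using val_intCast_le w (β' - 1)
        calc w.valuation F ((β' : F) - 1) * exp (-2 : ℤ) ≤ 1 * 1 := by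
              gcongr; exact exp_le_exp.mpr (by norm_num) |>.trans (le_of_eq exp_zero)
          _ = 1 := one_mul 1
      · rw [map_mul, map_pow, hvϖ, ← exp_nsmul]
        have : w.valuation F ((α' : F) + (ε : F)) ≤ 1 := by simpa using val_intCast_le w (α' + ε)
        calc w.valuation F ((α' : F) + (ε : F)) * exp ((2 : ℕ) • (-2 : ℤ)) ≤ 1 * 1 := by
              gcongr; exact exp_le_exp.mpr (by norm_num) |>.trans (le_of_eq exp_zero)
          _ = 1 := one_mul 1
    calc exp (-12 : ℤ) * _ ≤ exp (-12 : ℤ) * 1 := by gcongr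
      _ = exp ((6 : ℕ) • (-2 : ℤ)) := by rw [mul_one]; norm_num
  · -- the discriminant
    have hDF : ((A : F) ^ 2 * (B : F) ^ 2 - 4 * (B : F) ^ 3 - 4 * (A : F) ^ 3 * (C : F)
        - 27 * (C : F) ^ 2 + 18 * (A : F) * (B : F) * (C : F)) = 81 * (d : F) := by
      have := congrArg (Int.cast : ℤ → F) hD
      push_cast at this
      exact this
    rw [hDF, map_mul, map_mul, show (81 : F) = 3 ^ 4 by norm_num, map_pow, h3,
      show (16 : F) = ((16 : ℤ) : F) by norm_num, hcop 16 (by norm_num), hcop d hd, hvu,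
      ← exp_nsmul, ← exp_nsmul, one_mul, mul_one]
    norm_num

include hπ h3 hcop in
/-- **Kernel, `v₃(disc) = 6`, `3 ∣ A`, `9 ∣ B`, `27 ∣ C` (Kodaira I₀*-shaped rows):** witness
`r = 0`, `u = (ζ − 1)³`. [cite: Kraus1990, Théorème 1 (p = 3)] -/
theorem hasGoodReductionAt_of_pattern_six_zero (A B C a b c d : ℤ)
    (hA : A = 3 * a) (hB : B = 9 * b) (hC : C = 27 * c)
    (hD : A ^ 2 * B ^ 2 - 4 * B ^ 3 - 4 * A ^ 3 * C - 27 * C ^ 2 + 18 * A * B * C = 729 * d)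
    (hd : ¬ (3 : ℤ) ∣ d) :
    (⟨0, (A : F), 0, (B : F), (C : F)⟩ : WeierstrassCurve F).HasGoodReductionAt w := by
  have hπ0 : (ζ - 1 : F) ≠ 0 := zeta_sub_one_ne_zero' w hπ
  have hu0 : (ζ - 1) ^ 3 ≠ 0 := pow_ne_zero _ hπ0
  have hvu : w.valuation F ((ζ - 1) ^ 3) = exp (-3 : ℤ) := by
    rw [map_pow, hπ, ← exp_nsmul]; norm_num
  refine hasGoodReductionAt_of_translate_scale w (A : F) (B : F) (C : F) 0
    ((ζ - 1) ^ 3) hu0 ?_ ?_ ?_ ?_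
  · rw [mul_zero, add_zero, hvu, ← exp_nsmul]
    have : (A : F) = ((3 ^ 1 * a : ℤ) : F) := by rw [hA]; push_cast; ring
    rw [this]; simpa using val_three_pow_mul_le w h3 1 a
  · rw [show (B : F) + 2 * 0 * (A : F) + 3 * 0 ^ 2 = (B : F) by ring, hvu, ← exp_nsmul]
    have : (B : F) = ((3 ^ 2 * b : ℤ) : F) := by rw [hB]; push_cast; ring
    rw [this]; simpa using val_three_pow_mul_le w h3 2 b
  · rw [show (C : F) + 0 * (B : F) + 0 ^ 2 * (A : F) + 0 ^ 3 = (C : F) by ring, hvu, ← exp_nsmul]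
    have : (C : F) = ((3 ^ 3 * c : ℤ) : F) := by rw [hC]; push_cast; ring
    rw [this]; simpa using val_three_pow_mul_le w h3 3 c
  · have hDF : ((A : F) ^ 2 * (B : F) ^ 2 - 4 * (B : F) ^ 3 - 4 * (A : F) ^ 3 * (C : F)
        - 27 * (C : F) ^ 2 + 18 * (A : F) * (B : F) * (C : F)) = 729 * (d : F) := by
      have := congrArg (Int.cast : ℤ → F) hD
      push_cast at this
      exact this
    rw [hDF, map_mul, map_mul, show (729 : F) = 3 ^ 6 by norm_num, map_pow, h3,
      show (16 : F) = ((16 : ℤ) : F) by norm_num, hcop 16 (by norm_num), hcop d hd, hvu,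
      ← exp_nsmul, ← exp_nsmul, one_mul, mul_one]
    norm_num

include hζ hπ h3 hcop in
/-- **Kernel, `v₃(disc) = 6`, `9 ∣ A`, `B ≡ −9 (mod 27)`, `C ≡ −9ε (mod 27)` (Kodaira IV rows of
the principal-series cell):** witness `r = ε ϖ²`, `u = (ζ − 1)³`.
[cite: Kraus1990, Théorème 1 (p = 3)] -/
theorem hasGoodReductionAt_of_pattern_six (A B C ε α₁ β₂ γ₂ d : ℤ) (hε : ε = 1 ∨ ε = -1)
    (hA : A = 9 * α₁) (hB : B = -9 + 27 * β₂) (hC : C = -9 * ε + 27 * γ₂)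
    (hD : A ^ 2 * B ^ 2 - 4 * B ^ 3 - 4 * A ^ 3 * C - 27 * C ^ 2 + 18 * A * B * C = 729 * d)
    (hd : ¬ (3 : ℤ) ∣ d) :
    (⟨0, (A : F), 0, (B : F), (C : F)⟩ : WeierstrassCurve F).HasGoodReductionAt w := by
  set ϖ : F := 2 - ζ - ζ ^ 8 with hϖdef
  have hvϖ : w.valuation F ϖ = exp (-2 : ℤ) := val_varpi hζ w hπ
  have hϖ3 : ϖ ^ 3 = 3 - 9 * ϖ + 6 * ϖ ^ 2 := varpi_cube hζ
  have hπ0 : (ζ - 1 : F) ≠ 0 := zeta_sub_one_ne_zero' w hπ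
  have hu0 : (ζ - 1) ^ 3 ≠ 0 := pow_ne_zero _ hπ0
  have hvu : w.valuation F ((ζ - 1) ^ 3) = exp (-3 : ℤ) := by
    rw [map_pow, hπ, ← exp_nsmul]; norm_num
  have hvε : w.valuation F (ε : F) = 1 := by rcases hε with rfl | rfl <;> simp
  have hv9 : w.valuation F (9 : F) = exp (-12 : ℤ) := by
    rw [show (9 : F) = 3 ^ 2 by norm_num, map_pow, h3, ← exp_nsmul]; norm_num
  have hv27 : w.valuation F (27 : F) = exp (-18 : ℤ) := by
    rw [show (27 : F) = 3 ^ 3 by norm_num, map_pow, h3, ← exp_nsmul]; norm_num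
  -- `w(P(ϖ)) ≤ 1` for a short integral polynomial in `ϖ`
  have hpoly : ∀ x y z : ℤ, w.valuation F ((x : F) + (y : F) * ϖ + (z : F) * ϖ ^ 2) ≤ 1 := by
    intro x y z
    refine val_add_le w (val_add_le w (val_intCast_le w _) ?_) ?_
    · rw [map_mul, hvϖ]
      calc w.valuation F (y : F) * exp (-2 : ℤ) ≤ 1 * 1 := by
            gcongr
            · exact val_intCast_le w y
            · exact exp_le_exp.mpr (by norm_num) |>.trans (le_of_eq exp_zero)
        _ = 1 := one_mul 1
    · rw [map_mul, map_pow, hvϖ, ← exp_nsmul]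
      calc w.valuation F (z : F) * exp ((2 : ℕ) • (-2 : ℤ)) ≤ 1 * 1 := by
            gcongr
            · exact val_intCast_le w z
            · exact exp_le_exp.mpr (by norm_num) |>.trans (le_of_eq exp_zero)
        _ = 1 := one_mul 1
  refine hasGoodReductionAt_of_translate_scale w (A : F) (B : F) (C : F) ((ε : F) * ϖ ^ 2)
    ((ζ - 1) ^ 3) hu0 ?_ ?_ ?_ ?_
  · -- `A + 3r = 3·(3α₁ + ε ϖ²)`
    have key : (A : F) + 3 * ((ε : F) * ϖ ^ 2) =
        3 * (((3 * α₁ : ℤ) : F) + ((0 : ℤ) : F) * ϖ + ((ε : ℤ) : F) * ϖ ^ 2) := by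
      rw [hA]; push_cast; ring
    rw [key, map_mul, h3, hvu, ← exp_nsmul]
    calc exp (-6 : ℤ) * _ ≤ exp (-6 : ℤ) * 1 := by gcongr; exact hpoly _ _ _
      _ = exp ((2 : ℕ) • (-3 : ℤ)) := by rw [mul_one]; norm_num
  · -- `B + 2rA + 3r² = 9·(5 + 3β₂ − 17ϖ + (2εα₁ + 9)ϖ²)`
    have key : (B : F) + 2 * ((ε : F) * ϖ ^ 2) * (A : F) + 3 * ((ε : F) * ϖ ^ 2) ^ 2 =
        9 * (((5 + 3 * β₂ : ℤ) : F) + ((-17 : ℤ) : F) * ϖ + ((2 * ε * α₁ + 9 : ℤ) : F) * ϖ ^ 2) := by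
      rw [hA, hB]; push_cast
      rcases hε with rfl | rfl
      · push_cast; linear_combination (3 * (6 + ϖ)) * hϖ3
      · push_cast; linear_combination (3 * (6 + ϖ)) * hϖ3
    rw [key, map_mul, hv9, hvu, ← exp_nsmul]
    calc exp (-12 : ℤ) * _ ≤ exp (-12 : ℤ) * 1 := by gcongr; exact hpoly _ _ _
      _ = exp ((4 : ℕ) • (-3 : ℤ)) := by rw [mul_one]; norm_num
  · -- `C + rB + r²A + r³ = 27·((12ε + γ₂ + 6α₁) + (−17α₁ − 34ε)ϖ + (16ε + εβ₂ + 9α₁)ϖ²)`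
    have key : (C : F) + ((ε : F) * ϖ ^ 2) * (B : F) + ((ε : F) * ϖ ^ 2) ^ 2 * (A : F)
        + ((ε : F) * ϖ ^ 2) ^ 3 =
        27 * (((12 * ε + γ₂ + 6 * α₁ : ℤ) : F) + ((-17 * α₁ - 34 * ε : ℤ) : F) * ϖ
          + ((16 * ε + ε * β₂ + 9 * α₁ : ℤ) : F) * ϖ ^ 2) := by
      rw [hA, hB, hC]; push_cast
      rcases hε with rfl | rfl
      · push_cast
        linear_combination ((111 + 27 * ϖ + 6 * ϖ ^ 2 + ϖ ^ 3) + 9 * (α₁ : F) * (6 + ϖ)) * hϖ3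
      · push_cast
        linear_combination (-(111 + 27 * ϖ + 6 * ϖ ^ 2 + ϖ ^ 3) + 9 * (α₁ : F) * (6 + ϖ)) * hϖ3
    rw [key, map_mul, hv27, hvu, ← exp_nsmul]
    calc exp (-18 : ℤ) * _ ≤ exp (-18 : ℤ) * 1 := by gcongr; exact hpoly _ _ _
      _ = exp ((6 : ℕ) • (-3 : ℤ)) := by rw [mul_one]; norm_num
  · have hDF : ((A : F) ^ 2 * (B : F) ^ 2 - 4 * (B : F) ^ 3 - 4 * (A : F) ^ 3 * (C : F)
        - 27 * (C : F) ^ 2 + 18 * (A : F) * (B : F) * (C : F)) = 729 * (d : F) := by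
      have := congrArg (Int.cast : ℤ → F) hD
      push_cast at this
      exact this
    rw [hDF, map_mul, map_mul, show (729 : F) = 3 ^ 6 by norm_num, map_pow, h3,
      show (16 : F) = ((16 : ℤ) : F) by norm_num, hcop 16 (by norm_num), hcop d hd, hvu,
      ← exp_nsmul, ← exp_nsmul, one_mul, mul_one]
    norm_num

include hζ in
/-- **The `ℚ(√−3)`-twist, rescaled** (`√−3 = 2ζ³ + 1 ∈ F`, `u = √−3`): `y² = x³ + 3a x² + 9b x + 27c`
has good reduction at `w` iff `y² = x³ − a x² + b x − c` does. On the wild cell this lowers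
`v₃(disc)` by `6` (Kodaira IV* ↦ II, II* ↦ IV, I₀* ↦ good). [cite: SilvermanAEC2009, X.5.4] -/
theorem hasGoodReductionAt_iff_twistScale (a b c : F) :
    (⟨0, 3 * a, 0, 9 * b, 27 * c⟩ : WeierstrassCurve F).HasGoodReductionAt w ↔
      (⟨0, -a, 0, b, -c⟩ : WeierstrassCurve F).HasGoodReductionAt w := by
  set s : F := 2 * ζ ^ 3 + 1 with hsdef
  have hs2 : s ^ 2 = -3 := sq_two_zeta_cube_add_one hζ
  have hs0 : s ≠ 0 := by
    intro h0; rw [h0] at hs2; norm_num at hs2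
  set V : WeierstrassCurve F := ⟨0, 3 * a, 0, 9 * b, 27 * c⟩ with hVdef
  set Cv : VariableChange F := ⟨Units.mk0 s hs0, 0, 0, 0⟩ with hCv
  have hCu : (↑Cv.u⁻¹ : F) = s⁻¹ := by rw [Units.val_inv_eq_inv_val, hCv, Units.val_mk0]
  have hs4 : s ^ 4 = 9 := by rw [show s ^ 4 = (s ^ 2) ^ 2 by ring, hs2]; norm_num
  have hs6 : s ^ 6 = -27 := by rw [show s ^ 6 = (s ^ 2) ^ 3 by ring, hs2]; norm_num
  have hCV : Cv • V = ⟨0, -a, 0, b, -c⟩ := by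
    ext
    · rw [variableChange_a₁]; simp only [hCv, hVdef]; simp
    · rw [variableChange_a₂, hCu]; simp only [hCv, hVdef]
      rw [inv_pow, hs2]; field_simp; ring
    · rw [variableChange_a₃]; simp only [hCv, hVdef]; simp
    · rw [variableChange_a₄, hCu]; simp only [hCv, hVdef]
      rw [inv_pow, hs4]; field_simp; ring
    · rw [variableChange_a₆, hCu]; simp only [hCv, hVdef]
      rw [inv_pow, hs6]; field_simp; ring
  rw [← hCV]
  exact (hasGoodReductionAt_smul_iff_holds w V Cv).symm

end Nine

end Summit.BirchSwinnertonDyer.BirchSwinnertonDyer.Theorems.GNineCriterion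

end
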